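import Summits.CriticalPhenomena.CardyFormulaZ2.Theorems.CardySelfRefinementLagHandOffHalfPlaneTwoArmUndockedDocking
import Summits.CriticalPhenomena.CardyFormulaZ2.Theorems.CardySelfRefinementLagHandOffHalfPlaneTwoArmUndockedDockedBound
import Summits.CriticalPhenomena.CardyFormulaZ2.Theorems.CardySelfRefinementLagHandOffHalfPlaneTwoArmUndockedSumTools
import HarnessLib

/-!
# The multiscale sum of the undocked half-plane two-arm bound

Support file for the registered stub `stub_noTouch_undockedThreeArm` of crux
stmt-CriticalPhenomena-10268 (line `hitting-tournament`), towards the undocked half-plane two-arm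
bound (X) for critical bond percolation on `ℤ²` (hypothesis of the landed
`stub_noTouch_undockedThreeArm_of_twoArm`).  Assume the undocked two-arm bound with SOME exponent
`θ > 0` (and constants `C, c_b, K`), and the RSW bound `(r/R)^α` for closed dual crossings of
annuli.  Around a lattice point `c₀`, with scales `s_j = r₀ L^j` (`r₀ = 2r + 9`) and shells
`[s_j, S'_j]`, `S'_j = L s_j / 4`, the two arms of the undocked two-arm event `E(c₀; r, R)` either
dock at scale `j` (event `D_j`, probability `≤ C_d S'_j / (R/2)`, `stub_undockedTwoArm_real_dock_le`)
or produce three arms at scale `j` for `ω` or for `dualConfig ω` (event `B_j`, probability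
`≤ A L^{-(θ+α)}` by Reimer's inequality, `A = 2 C 2^θ 32^α`), by
`stub_undockedTwoArm_dockOrThreeArms`; the `B_j` are determined by pairwise disjoint annuli of
edges, disjoint from the annulus determining `D_j` for `i < j` (`…UndockedLocality`).  Decomposing
according to the first scale at which docking occurs (independence of disjoint edge sets):

* `stub_undockedTwoArm_sumBound` (using `real_le_sum_firstFail` and
  `stub_undockedTwoArm_threeArmScale_le` of `…UndockedSumTools`) — **`P(E(c₀; r, R)) ≤ (C_d r₀ L / (2R)) Σ_{j<J} (L q)^j + q^J`**,
  `q = A L^{-(θ+α)}`, for every `L ≥ max 32 (2K)` and every number of scales `J` with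
  `K_d r₀ L^J ≤ R`.

References: H. Kesten, Comm. Math. Phys. 109 (1987), proof of Lemma 4 (first good scale)
[KestenScalingCMP1987]; P. Nolin, Electron. J. Probab. 13 (2008), §4.5 [Nolin2008]; D. Reimer,
Combin. Probab. Comput. 9 (2000) [ReimerCPC2000]; G. Grimmett, *Percolation* (1999), §2.2–2.3
[GrimmettPercolation1999].
-/

noncomputable section

open Set Metric Complex MeasureTheory
open Literature.Probability.Percolation Literature.Probability.LatticeModels

namespace Summit.CriticalPhenomena.CardyFormulaZ2.Cruxes.LagHandOff.HittingTournament

/-! ### The sum bound -/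

/-- **The multiscale sum bound.**  Assume the undocked two-arm bound with exponent `θ > 0` and
constants `C, c_b, K`, and the RSW bound `(r/R)^α` (`α > 0`) for closed dual annulus crossings.
Then there are `C_d > 0`, `K_d ≥ 1` such that for every `L ≥ max 32 (2K)`, every lattice point
`c₀`, all `r ≥ max (2 c_b) (max c_a 16)`, `R`, and every number of scales `J` with
`K_d (2r + 9) L^J ≤ R`, the undocked two-arm event around `c₀` at mesh `1` with radii `r, R` has
probability at most `(C_d (2r+9) L / (2R)) Σ_{j<J} (L q)^j + q^J`, `q = 2 C 2^θ 32^α L^{-(θ+α)}`.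
[cite: KestenScalingCMP1987, proof of Lemma 4] -/
theorem stub_undockedTwoArm_sumBound : ∀ {θ C cb K : ℝ}, 0 < θ → 0 < C → 0 < cb → 1 ≤ K →
    (∀ (x : ℂ) (δ r R : ℝ), 0 < δ → cb * δ ≤ r → K * r ≤ R → ∀ S : Set (Site 2),
      S = {v | r ≤ dist (meshPoint δ v) x ∧ dist (meshPoint δ v) x ≤ R ∧ x.im ≤ (meshPoint δ v).im} →
      (bondPercolation (zdGraph 2) half).real {ω | ∃ v w f g : Site 2,
        dist (meshPoint δ v) x ≤ 2 * r ∧ dist (meshPoint δ f) x ≤ 2 * r ∧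
        R / 2 ≤ dist (meshPoint δ w) x ∧ R / 2 ≤ dist (meshPoint δ g) x ∧
        ω ∈ openConnIn S v w ∧ dualConfig ω ∈ openConnIn S f g} ≤ C * (r / R) ^ θ) →
    ∀ {α ca : ℝ}, 0 < α → 0 < ca →
    (∀ (x : ℂ) (δ r R : ℝ), 0 < δ → ca * δ ≤ r → 2 * r ≤ R →
      (bondPercolation (zdGraph 2) half).real (annulusDualCrossing x δ r R) ≤ (r / R) ^ α) →
    ∃ Cd Kd : ℝ, 0 < Cd ∧ 1 ≤ Kd ∧ ∀ (L : ℝ), max 32 (2 * K) ≤ L → ∀ (c₀ : Site 2) (r R : ℝ) (J : ℕ),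
    max (2 * cb) (max ca 16) ≤ r → Kd * (2 * r + 9) * L ^ J ≤ R →
    (bondPercolation (zdGraph 2) half).real {ω | ∃ v w f g : Site 2,
        dist (meshPoint 1 v) (meshPoint 1 c₀) ≤ 2 * r ∧ dist (meshPoint 1 f) (meshPoint 1 c₀) ≤ 2 * r ∧
        R / 2 ≤ dist (meshPoint 1 w) (meshPoint 1 c₀) ∧ R / 2 ≤ dist (meshPoint 1 g) (meshPoint 1 c₀) ∧
        ω ∈ openConnIn {v : Site 2 | r ≤ dist (meshPoint 1 v) (meshPoint 1 c₀) ∧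
          dist (meshPoint 1 v) (meshPoint 1 c₀) ≤ R ∧ (meshPoint 1 c₀).im ≤ (meshPoint 1 v).im} v w ∧
        dualConfig ω ∈ openConnIn {v : Site 2 | r ≤ dist (meshPoint 1 v) (meshPoint 1 c₀) ∧
          dist (meshPoint 1 v) (meshPoint 1 c₀) ≤ R ∧ (meshPoint 1 c₀).im ≤ (meshPoint 1 v).im} f g} ≤
      (Cd * (2 * r + 9) * L / (2 * R)) * ∑ j ∈ Finset.range J, (L * (2 * C * 2 ^ θ * 32 ^ α * L ^ (-(θ + α)))) ^ j +
        (2 * C * 2 ^ θ * 32 ^ α * L ^ (-(θ + α))) ^ J := by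
  intro θ C cb K hθ hC hcb hK hX α ca hα hca hRSW
  obtain ⟨Cd, Kd, hCd, hKd, hdock⟩ := stub_undockedTwoArm_real_dock_le
  refine ⟨Cd, Kd + 9, hCd, by linarith, fun L hL c₀ r R J hr hR => ?_⟩
  classical
  set μ := bondPercolation (zdGraph 2) half with hμ
  set c := meshPoint 1 c₀ with hc
  set c₀' : Site 2 := c₀ - Pi.single 1 1 with hc₀'
  set c' := meshPoint 1 c₀' with hc'
  set k : ℤ := c₀ 1 with hk
  set r₀ : ℝ := 2 * r + 9 with hr₀
  set A : ℝ := 2 * C * 2 ^ θ * 32 ^ α with hA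
  set q : ℝ := A * L ^ (-(θ + α)) with hq
  -- thresholds
  have hL32 : 32 ≤ L := le_trans (le_max_left _ _) hL
  have hLK : 2 * K ≤ L := le_trans (le_max_right _ _) hL
  have hL1 : 1 ≤ L := by linarith
  have hL0 : 0 < L := by linarith
  have hr16 : 16 ≤ r := le_trans ((le_max_right _ _).trans (le_max_right _ _)) hr
  have hrcb : 2 * cb ≤ r := le_trans (le_max_left _ _) hr
  have hrca : ca ≤ r := le_trans ((le_max_left _ _).trans (le_max_right _ _)) hr
  have hr₀16 : 16 ≤ r₀ := by rw [hr₀]; linarith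
  have hcc' : dist c' c ≤ 1 := by
    rw [hc', hc₀', hc, meshPoint_sub_single_one, dist_eq_norm, sub_sub_cancel_left, norm_neg, Complex.norm_I]
  -- scales
  set sc : ℕ → ℝ := fun j => r₀ * L ^ j with hsc
  set Sc : ℕ → ℝ := fun j => L * (r₀ * L ^ j) / 4 with hSc
  have hsc_pos : ∀ j, r₀ ≤ sc j := fun j => by
    show r₀ ≤ r₀ * L ^ j
    have h := mul_le_mul_of_nonneg_left (one_le_pow₀ (M₀ := ℝ) hL1 (n := j)) (show (0 : ℝ) ≤ r₀ by linarith)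
    rw [mul_one] at h
    exact h
  have hsc_mono : ∀ i j, i ≤ j → sc i ≤ sc j := fun i j hij => by
    show r₀ * L ^ i ≤ r₀ * L ^ j
    exact mul_le_mul_of_nonneg_left (pow_le_pow_right₀ hL1 hij) (by linarith)
  have hSc_eq : ∀ j, Sc j = L * sc j / 4 := fun j => rfl
  have hSc_ge : ∀ j, 4 * sc j ≤ Sc j := fun j => by
    rw [hSc_eq]
    have h := mul_le_mul_of_nonneg_right (show (16 : ℝ) ≤ L by linarith) (show (0 : ℝ) ≤ sc j by linarith [hsc_pos j])
    linarith
  have hsc_succ : ∀ j, sc (j + 1) = 4 * Sc j := fun j => by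
    show r₀ * L ^ (j + 1) = 4 * (L * (r₀ * L ^ j) / 4); ring
  have hSc_le : ∀ j < J, (Kd + 9) * Sc j ≤ R / 2 := fun j hj => by
    have h1 : Sc j ≤ r₀ * L ^ J / 4 := by
      rw [hSc_eq]
      have : L * sc j = sc (j + 1) := by show L * (r₀ * L ^ j) = r₀ * L ^ (j + 1); ring
      rw [this]
      have := hsc_mono (j + 1) J hj
      show r₀ * L ^ (j + 1) / 4 ≤ r₀ * L ^ J / 4
      linarith [this]
    have hKd0 : 0 ≤ Kd + 9 := by linarith
    have hpos : 0 ≤ (Kd + 9) * r₀ * L ^ J := by positivity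
    calc (Kd + 9) * Sc j ≤ (Kd + 9) * (r₀ * L ^ J / 4) := mul_le_mul_of_nonneg_left h1 hKd0
      _ = ((Kd + 9) * r₀ * L ^ J) / 4 := by ring
      _ ≤ R / 2 := by linarith [hR]
  have hSc_R : ∀ j < J, Sc j + 9 ≤ R / 2 ∧ Kd * Sc j ≤ R / 2 ∧ 0 < R := fun j hj => by
    have h := hSc_le j hj
    have hS0 : 1 ≤ Sc j := by have := hSc_ge j; have := hsc_pos j; linarith
    have h1 : 1 * Sc j ≤ Kd * Sc j := mul_le_mul_of_nonneg_right hKd (by linarith)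
    have h2 : (Kd + 9) * Sc j = Kd * Sc j + 9 * Sc j := by ring
    rw [h2] at h
    rw [one_mul] at h1
    refine ⟨by linarith, by linarith, by linarith⟩
  -- the events of the scales
  obtain ⟨E, hE⟩ : ∃ E : Set (BondConfig (Site 2)), E = {ω | ∃ v w f g : Site 2,
        dist (meshPoint 1 v) c ≤ 2 * r ∧ dist (meshPoint 1 f) c ≤ 2 * r ∧
        R / 2 ≤ dist (meshPoint 1 w) c ∧ R / 2 ≤ dist (meshPoint 1 g) c ∧
        ω ∈ openConnIn {v : Site 2 | r ≤ dist (meshPoint 1 v) c ∧ dist (meshPoint 1 v) c ≤ R ∧ c.im ≤ (meshPoint 1 v).im} v w ∧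
        dualConfig ω ∈ openConnIn {v : Site 2 | r ≤ dist (meshPoint 1 v) c ∧ dist (meshPoint 1 v) c ≤ R ∧ c.im ≤ (meshPoint 1 v).im} f g} :=
    ⟨_, rfl⟩
  rw [← hE]
  obtain ⟨D, hDdef⟩ : ∃ D : ℕ → Set (BondConfig (Site 2)), D = fun j =>
    {ω : BondConfig (Site 2) | ∃ b w : Site 2, (b ∈ {v : Site 2 | sc j ≤ dist (meshPoint 1 v) c ∧ dist (meshPoint 1 v) c ≤ Sc j ∧ c₀ 1 ≤ v 1} ∧ b 1 = c₀ 1) ∧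
        R / 2 ≤ dist (meshPoint 1 w) c ∧
        ω ∈ openConnIn {v : Site 2 | sc j - 9 ≤ dist (meshPoint 1 v) c ∧ dist (meshPoint 1 v) c ≤ R ∧ c₀ 1 ≤ v 1} b w} ∩
    {ω : BondConfig (Site 2) | ∃ m g : Site 2, (m ∈ {v : Site 2 | sc j ≤ dist (meshPoint 1 v) c' ∧ dist (meshPoint 1 v) c' ≤ Sc j ∧ c₀' 1 ≤ v 1} ∧ m 1 = c₀' 1) ∧
        R / 2 - 1 ≤ dist (meshPoint 1 g) c' ∧
        dualConfig ω ∈ openConnIn {v : Site 2 | (c₀ 1 ≤ v 1 ∧ sc j - 9 ≤ dist (meshPoint 1 v) c' ∧ dist (meshPoint 1 v) c' ≤ R + 1) ∨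
          (v 1 = c₀' 1 ∧ sc j ≤ dist (meshPoint 1 v) c' ∧ dist (meshPoint 1 v) c' ≤ Sc j)} m g} := ⟨_, rfl⟩
  obtain ⟨TA, hTAdef⟩ : ∃ TA : ℂ → ℕ → Set (BondConfig (Site 2)), TA = fun x j =>
    {ω : BondConfig (Site 2) | ∃ v w f g : Site 2,
        dist (meshPoint 1 v) x ≤ 2 * (sc j / 2) ∧ dist (meshPoint 1 f) x ≤ 2 * (sc j / 2) ∧
        Sc j / 2 ≤ dist (meshPoint 1 w) x ∧ Sc j / 2 ≤ dist (meshPoint 1 g) x ∧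
        ω ∈ openConnIn {v : Site 2 | sc j / 2 ≤ dist (meshPoint 1 v) x ∧ dist (meshPoint 1 v) x ≤ Sc j ∧ x.im ≤ (meshPoint 1 v).im} v w ∧
        dualConfig ω ∈ openConnIn {v : Site 2 | sc j / 2 ≤ dist (meshPoint 1 v) x ∧ dist (meshPoint 1 v) x ≤ Sc j ∧ x.im ≤ (meshPoint 1 v).im} f g} □
      {ω : BondConfig (Site 2) | ∃ f g : Site 2, dist (meshPoint 1 f) x ≤ 2 * sc j + 2 ∧
        Sc j - 9 ≤ dist (meshPoint 1 g) x ∧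
        dualConfig ω ∈ openConnIn {v : Site 2 | 2 * sc j + 1 ≤ dist (meshPoint 1 v) x ∧ dist (meshPoint 1 v) x ≤ Sc j - 8} f g} :=
    ⟨_, rfl⟩
  obtain ⟨B, hBdef⟩ : ∃ B : ℕ → Set (BondConfig (Site 2)), B = fun j => TA c j ∪ dualConfig ⁻¹' TA c' j := ⟨_, rfl⟩
  -- the per-scale inclusion on lattice configurations
  have hincl : ∀ ω : BondConfig (Site 2), ω ⊆ (zdGraph 2).edgeSet → ω ∈ E → ∀ j < J, ω ∈ D j ∨ ω ∈ B j := by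
    intro ω hω hωE j hj
    rw [hE] at hωE
    obtain ⟨v, w, f, g, hv, hf, hw, hg, ho, hcl⟩ := hωE
    obtain ⟨Po, hPoS, hPoω⟩ := exists_walk_of_mem_openConnIn hω ho
    obtain ⟨Pc, hPcS, hPcω⟩ := Z2HalfPlane.exists_walk_of_dualConfig_mem_openConnIn hcl
    have hsj := hsc_pos j
    have hScj := hSc_le j hj
    have hrowS : ∀ z : Site 2, z ∈ {v : Site 2 | r ≤ dist (meshPoint 1 v) c ∧ dist (meshPoint 1 v) c ≤ R ∧ c.im ≤ (meshPoint 1 v).im} →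
        c₀ 1 ≤ z 1 ∧ dist (meshPoint 1 z) c ≤ R := fun z hz => by
      obtain ⟨-, h2, h3⟩ := hz
      rw [hc, meshPoint_im, meshPoint_im, one_mul, one_mul] at h3
      exact ⟨by exact_mod_cast h3, h2⟩
    obtain ⟨hScR, -, hRpos⟩ := hSc_R j hj
    have h := stub_undockedTwoArm_dockOrThreeArms hω c₀ (s := sc j) (S' := Sc j) (R₂ := R / 2) (R₃ := R)
      (by linarith) (hSc_ge j) hScR (by linarith)
      Po hPoω (fun z hz => hrowS z (hPoS z hz)) (by rw [← hc]; rw [hr₀] at hsj; linarith) (by rw [← hc]; exact hw)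
      Pc hPcω (fun z hz => hrowS z (hPcS z hz)) (by rw [← hc]; rw [hr₀] at hsj; linarith) (by rw [← hc]; exact hg)
      c₀' rfl _ _ _ _ _ _ _ _ rfl rfl rfl rfl rfl rfl rfl rfl
    rw [hDdef, hBdef, hTAdef]
    rcases h with (h | h) | h
    · exact Or.inl h
    · exact Or.inr (Or.inl h)
    · exact Or.inr (Or.inr h)
  -- locality of the events
  have hdetD : ∀ j < J, DeterminedBy (D j) {e : Sym2 (Site 2) | ∀ y ∈ e, sc j - 14 ≤ dist (meshPoint 1 y) c ∧ dist (meshPoint 1 y) c ≤ R + 6} := by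
    intro j hj
    rw [hDdef]
    refine DeterminedBy.inter ?_ ?_
    · refine (determinedBy_openArm c (sc j - 9) R _ (fun v hv => ⟨hv.1, hv.2.1⟩) _ _).mono (edgeAnnulus_mono c (by linarith) (by linarith))
    · refine ((determinedBy_dualArm c' (sc j - 9) (R + 1) _ (fun v hv => ?_) _ _).mono
        (edgeAnnulus_mono_centre hcc' _ _)).mono (edgeAnnulus_mono c (by linarith) (by linarith))
      rcases hv with ⟨-, h2, h3⟩ | ⟨-, h2, h3⟩
      · exact ⟨h2, h3⟩
      · obtain ⟨h4, -, hR0⟩ := hSc_R j hj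
        exact ⟨by linarith, by linarith⟩
  have hdetU : ∀ (x : ℂ) (j : ℕ), DeterminedBy {ω : BondConfig (Site 2) | ∃ v w f g : Site 2,
        dist (meshPoint 1 v) x ≤ 2 * (sc j / 2) ∧ dist (meshPoint 1 f) x ≤ 2 * (sc j / 2) ∧
        Sc j / 2 ≤ dist (meshPoint 1 w) x ∧ Sc j / 2 ≤ dist (meshPoint 1 g) x ∧
        ω ∈ openConnIn {v : Site 2 | sc j / 2 ≤ dist (meshPoint 1 v) x ∧ dist (meshPoint 1 v) x ≤ Sc j ∧ x.im ≤ (meshPoint 1 v).im} v w ∧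
        dualConfig ω ∈ openConnIn {v : Site 2 | sc j / 2 ≤ dist (meshPoint 1 v) x ∧ dist (meshPoint 1 v) x ≤ Sc j ∧ x.im ≤ (meshPoint 1 v).im} f g}
      {e : Sym2 (Site 2) | ∀ y ∈ e, (sc j / 2 - 4) ≤ dist (meshPoint 1 y) x ∧ dist (meshPoint 1 y) x ≤ Sc j + 4} :=
    fun x j => stub_undockedTwoArm_determinedBy_twoArm x (sc j / 2) (Sc j) _ (fun v hv => ⟨hv.1, hv.2.1⟩) _ _ _ _
  have hdetDual : ∀ (x : ℂ) (j : ℕ), DeterminedBy {ω : BondConfig (Site 2) | ∃ f g : Site 2, dist (meshPoint 1 f) x ≤ 2 * sc j + 2 ∧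
        Sc j - 9 ≤ dist (meshPoint 1 g) x ∧
        dualConfig ω ∈ openConnIn {v : Site 2 | 2 * sc j + 1 ≤ dist (meshPoint 1 v) x ∧ dist (meshPoint 1 v) x ≤ Sc j - 8} f g}
      {e : Sym2 (Site 2) | ∀ y ∈ e, (sc j / 2 - 4) ≤ dist (meshPoint 1 y) x ∧ dist (meshPoint 1 y) x ≤ Sc j + 4} := fun x j =>
    (determinedBy_dualArm x (2 * sc j + 1) (Sc j - 8) _ (fun v hv => hv) _ _).mono
      (edgeAnnulus_mono x (by linarith [hsc_pos j]) (by linarith))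
  have hdetB : ∀ j < J, DeterminedBy (B j) {e : Sym2 (Site 2) | ∀ y ∈ e, (sc j / 2 - 4) - 5 ≤ dist (meshPoint 1 y) c ∧
      dist (meshPoint 1 y) c ≤ (Sc j + 4) + 5} := fun j _ => by
    rw [hBdef, hTAdef]
    exact determinedBy_disjointOccurrence_union_preimage hcc' (hdetU c j) (hdetDual c j) (hdetU c' j) (hdetDual c' j)
  -- disjointness of the annuli
  have hsep : ∀ i j, i < j → Sc i + 4 + 5 < sc j / 2 - 4 - 5 := fun i j hij => by
    have h1 : sc (i + 1) ≤ sc j := hsc_mono (i + 1) j hij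
    rw [hsc_succ] at h1
    have h2 : 4 * r₀ ≤ Sc i := by have := hSc_ge i; have := hsc_pos i; linarith
    linarith
  have hdisjB : ∀ i j, i < j → j < J → Disjoint {e : Sym2 (Site 2) | ∀ y ∈ e, (sc i / 2 - 4) - 5 ≤ dist (meshPoint 1 y) c ∧
      dist (meshPoint 1 y) c ≤ (Sc i + 4) + 5} {e : Sym2 (Site 2) | ∀ y ∈ e, (sc j / 2 - 4) - 5 ≤ dist (meshPoint 1 y) c ∧
      dist (meshPoint 1 y) c ≤ (Sc j + 4) + 5} := fun i j hij _ => disjoint_edgeAnnulus c (hsep i j hij)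
  have hdisjD : ∀ i j, i < j → j < J → Disjoint {e : Sym2 (Site 2) | ∀ y ∈ e, (sc i / 2 - 4) - 5 ≤ dist (meshPoint 1 y) c ∧
      dist (meshPoint 1 y) c ≤ (Sc i + 4) + 5} {e : Sym2 (Site 2) | ∀ y ∈ e, sc j - 14 ≤ dist (meshPoint 1 y) c ∧
      dist (meshPoint 1 y) c ≤ R + 6} := fun i j hij _ =>
    disjoint_edgeAnnulus c (by have := hsep i j hij; have := hsc_pos j; linarith)
  -- the sum
  have hsum := real_le_sum_firstFail (E := E) (D := D) (B := B) (J := J)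
    (by filter_upwards [ae_subset_edgeSet (zdGraph 2) half] with ω hω hωE; exact hincl ω hω hωE)
    hdetD hdetB (fun j hj => measurableSet_of_determinedBy_edgeAnnulus (hdetD j hj))
    (fun j hj => measurableSet_of_determinedBy_edgeAnnulus (hdetB j hj)) hdisjB hdisjD
  -- the per-scale bounds
  have hDle : ∀ j < J, μ.real (D j) ≤ (Cd * r₀ * L / (2 * R)) * L ^ j := by
    intro j hj
    obtain ⟨-, hKdS, hR0⟩ := hSc_R j hj
    have h := hdock c₀ (sc j) (Sc j) (R / 2) R (by linarith [hsc_pos j]) (by linarith [hSc_ge j, hsc_pos j])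
      hKdS (by linarith) c₀' rfl _ _ _ _ rfl rfl rfl rfl
    rw [hDdef]
    calc _ ≤ Cd * Sc j / (R / 2) := h
      _ = (Cd * r₀ * L / (2 * R)) * L ^ j := by rw [hSc_eq]; show Cd * (L * (r₀ * L ^ j) / 4) / (R / 2) = _; field_simp; ring
  have hAeq : ∀ j, C * ((sc j / 2) / Sc j) ^ θ * ((2 * sc j + 2) / (Sc j - 9)) ^ α ≤ C * 2 ^ θ * 32 ^ α * L ^ (-(θ + α)) := by
    intro j
    have hs := hsc_pos j
    have h1 : (sc j / 2) / Sc j = 2 / L := by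
      have hs0 : (sc j) ≠ 0 := (show (0 : ℝ) < sc j by linarith).ne'
      rw [hSc_eq]; field_simp; ring
    have hLs : L * 16 ≤ L * sc j := mul_le_mul_of_nonneg_left (by linarith) hL0.le
    have h2 : (2 * sc j + 2) / (Sc j - 9) ≤ 32 / L := by
      rw [hSc_eq, div_le_div_iff₀ (by linarith) hL0]
      have e1 : (2 * sc j + 2) * L = 2 * (L * sc j) + 2 * L := by ring
      have e2 : 32 * (L * sc j / 4 - 9) = 8 * (L * sc j) - 288 := by ring
      rw [e1, e2]
      linarith
    have h2' : 0 ≤ (2 * sc j + 2) / (Sc j - 9) := div_nonneg (by linarith) (by have := hSc_ge j; linarith)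
    have h3 : ((2 * sc j + 2) / (Sc j - 9)) ^ α ≤ (32 / L) ^ α := Real.rpow_le_rpow h2' h2 hα.le
    have h4 : (2 / L) ^ θ * (32 / L) ^ α = 2 ^ θ * 32 ^ α * L ^ (-(θ + α)) := by
      rw [Real.div_rpow (by norm_num) hL0.le, Real.div_rpow (by norm_num) hL0.le, Real.rpow_neg hL0.le, Real.rpow_add hL0]
      field_simp
    calc C * ((sc j / 2) / Sc j) ^ θ * ((2 * sc j + 2) / (Sc j - 9)) ^ α
        ≤ C * ((sc j / 2) / Sc j) ^ θ * (32 / L) ^ α := by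
          apply mul_le_mul_of_nonneg_left h3; positivity
      _ = C * ((2 / L) ^ θ * (32 / L) ^ α) := by rw [h1]; ring
      _ = C * 2 ^ θ * 32 ^ α * L ^ (-(θ + α)) := by rw [h4]; ring
  have hTAle : ∀ (x₁ : ℂ) (j : ℕ), μ.real (TA x₁ j) ≤ C * 2 ^ θ * 32 ^ α * L ^ (-(θ + α)) := by
    intro x₁ j
    have hs := hsc_pos j
    have hK' : K * (sc j / 2) ≤ Sc j := by
      rw [hSc_eq]
      have h := mul_le_mul_of_nonneg_right hLK (show (0 : ℝ) ≤ sc j by linarith)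
      linarith
    have hsS' : 2 * (2 * sc j + 2) ≤ Sc j - 9 := by
      rw [hSc_eq]
      have h := mul_le_mul_of_nonneg_right hL32 (show (0 : ℝ) ≤ sc j by linarith)
      linarith
    have h := stub_undockedTwoArm_threeArmScale_le hX hRSW x₁ (s := sc j) (S' := Sc j) (by linarith) hK' (by linarith) hsS' _ _ rfl rfl
    rw [hTAdef]
    exact h.trans (hAeq j)
  have hBle : ∀ j, μ.real (B j) ≤ q := by
    intro j
    rw [hBdef]
    calc μ.real (TA c j ∪ dualConfig ⁻¹' TA c' j) ≤ μ.real (TA c j) + μ.real (dualConfig ⁻¹' TA c' j) := measureReal_union_le _ _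
      _ ≤ μ.real (TA c j) + μ.real (TA c' j) := add_le_add le_rfl (real_preimage_dualConfig_le _)
      _ ≤ C * 2 ^ θ * 32 ^ α * L ^ (-(θ + α)) + C * 2 ^ θ * 32 ^ α * L ^ (-(θ + α)) := add_le_add (hTAle c j) (hTAle c' j)
      _ = q := by rw [hq, hA]; ring
  have hq0 : 0 ≤ q := by rw [hq, hA]; positivity
  have hprod : ∀ j, ∏ i ∈ Finset.range j, μ.real (B i) ≤ q ^ j := fun j => by
    calc ∏ i ∈ Finset.range j, μ.real (B i) ≤ ∏ _i ∈ Finset.range j, q :=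
          Finset.prod_le_prod (fun _ _ => measureReal_nonneg) fun i _ => hBle i
      _ = q ^ j := by rw [Finset.prod_const, Finset.card_range]
  -- assembling
  have hR0 : 0 ≤ Cd * r₀ * L / (2 * R) ∨ J = 0 := by
    by_cases hJ : J = 0
    · exact Or.inr hJ
    · left
      obtain ⟨-, -, hR⟩ := hSc_R 0 (Nat.pos_of_ne_zero hJ)
      positivity
  calc μ.real E ≤ _ := hsum
    _ ≤ ∑ j ∈ Finset.range J, (Cd * r₀ * L / (2 * R)) * L ^ j * q ^ j + q ^ J := by
        refine add_le_add (Finset.sum_le_sum fun j hj => ?_) (hprod J)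
        have hjJ := Finset.mem_range.1 hj
        rcases hR0 with h0 | h0
        · exact mul_le_mul (hDle j hjJ) (hprod j) (Finset.prod_nonneg fun _ _ => measureReal_nonneg) (by positivity)
        · omega
    _ = (Cd * (2 * r + 9) * L / (2 * R)) * ∑ j ∈ Finset.range J, (L * q) ^ j + q ^ J := by
        rw [hr₀, Finset.mul_sum]
        congr 1
        refine Finset.sum_congr rfl fun j _ => ?_
        rw [mul_pow]; ring

end Summit.CriticalPhenomena.CardyFormulaZ2.Cruxes.LagHandOff.HittingTournament
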